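import Literature.Analysis.FluidPDE.TypeIAncientMild
import Literature.Analysis.FluidPDE.KNSSAxisymmetricNoSwirlHolds
import HarnessLib

/-!
# Stub `stub_noSwirlLiouville` of the line `absorbing-axis-swirl-extinction`
# (crux `AxisymEndLiouville`, stmt-NavierStokesRegularity-14061, route `SymmetryModuliCount`)

The swirl-free endgame of the line: an element `u` of the Type-I ancient mild class `𝒜_C`
(`IsTypeIAncientMild C u`) which is axisymmetric about the vertical axis (integrated sense,
`IsAxisymmetric (u t)`) and has no swirl (`HasNoSwirl (u t)`) at every `t < 0` vanishes
identically on `t < 0`.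

Proof: after a time shift by `δ = -s/2 > 0` the field `t ↦ u (t - δ)` is a bounded ancient mild
solution (`IsTypeIAncientMild.isBoundedAncientMildSolution_sub`) whose slices are still
measurable (`IsTypeIAncientMild.comp_sub_right`, `.aestronglyMeasurable_slice`), axisymmetric and
swirl free; KNSS 2009, Theorem 5.2, proved in the tree as `knss_axisymmetric_no_swirl_holds`,
makes every slice a.e. an axial constant `β • e_z`; continuity of the slices upgrades a.e. to
everywhere (`Continuous.ae_eq_iff_eq`); and the Oseen gauge kills slice-constant elements
(`IsTypeIAncientMild.eq_zero_of_slice_const`).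

## Contents

* `slice_eq_const_of_ae` — an a.e.-constant slice of an element of `𝒜_C` is constant.
* `stub_noSwirlLiouville` — the registered stub.
-/

-- the summit and its single problem share the name (D-0017 nested layout)
set_option linter.dupNamespace false

noncomputable section

namespace Summit.NavierStokesRegularity.NavierStokesRegularity.Theorems.AxisymEndLiouville.AbsorbingAxisSwirlExtinction

open MeasureTheory
open Literature.Analysis.FluidPDE

/-- `ℝ³`. -/
local notation "E3" => EuclideanSpace ℝ (Fin 3)

-- adapted from `slice_eq_const_of_ae` in
-- Summits/NavierStokesRegularity/NavierStokesRegularity/Cruxes/AxisymEndLiouville/Disproof.lean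
/-- From an a.e.-constant continuous slice to a pointwise constant one. -/
theorem slice_eq_const_of_ae {C : ℝ} {u : ℝ → E3 → E3} (hu : IsTypeIAncientMild C u)
    {s : ℝ} (hs : s < 0) {b : E3} (hb : u s =ᵐ[volume] fun _ => b) : ∀ x, u s x = b :=
  fun x => congrFun (((hu.continuous_slice hs).ae_eq_iff_eq volume continuous_const).1 hb) x

-- adapted from `vertical_noSwirl_past` in
-- Summits/NavierStokesRegularity/NavierStokesRegularity/Cruxes/AxisymEndLiouville/Disproof.lean
-- (the infinitesimal symmetry hypothesis there replaced by the integrated `haxi`)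
/-- **STUB 7 (swirl-free endgame).** A swirl-free axisymmetric element of `𝒜_C` vanishes
identically: after a time shift it is a bounded ancient mild solution
(`IsTypeIAncientMild.isBoundedAncientMildSolution_sub`), KNSS 2009 Thm 5.2
(`knss_axisymmetric_no_swirl_holds`, proved in the tree) makes every slice the a.e. axial constant
`β(t) • e_z`, continuity makes it a constant, and the gauge kills slice-constant elements
(`IsTypeIAncientMild.eq_zero_of_slice_const`). -/
theorem stub_noSwirlLiouville (C : ℝ) (u : ℝ → E3 → E3) (hu : IsTypeIAncientMild C u)
    (haxi : ∀ t < 0, IsAxisymmetric (u t)) (hsw : ∀ t < 0, HasNoSwirl (u t)) :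
    ∀ t < 0, ∀ x, u t x = 0 := by
  -- every slice is constant
  have hconst : ∀ s < 0, ∀ x, u s x = u s 0 := by
    intro s hs x
    have hδ : 0 < -s / 2 := by linarith
    have hv := hu.isBoundedAncientMildSolution_sub hδ
    have hv' := hu.comp_sub_right hδ.le
    obtain ⟨β, hβ⟩ := knss_axisymmetric_no_swirl_holds hv
      (fun t ht => hv'.aestronglyMeasurable_slice ht)
      (fun t ht => haxi _ (by linarith)) (fun t ht => hsw _ (by linarith)) (s / 2) (by linarith)
    have e : s / 2 - -s / 2 = s := by ring
    rw [e] at hβ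
    rw [slice_eq_const_of_ae hu hs hβ x, slice_eq_const_of_ae hu hs hβ 0]
  intro t ht x
  exact hu.eq_zero_of_slice_const (b := fun s => u s 0) hconst ht x

end Summit.NavierStokesRegularity.NavierStokesRegularity.Theorems.AxisymEndLiouville.AbsorbingAxisSwirlExtinction

end
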